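import Summits.RiemannHypothesis.RiemannHypothesis.Theses.SignCone
import Summits.RiemannHypothesis.RiemannHypothesis.Theorems.SignConeFakeWeightReduction
import HarnessLib

/-!
# Route SignCone, support item `SignConeUpTo210`: the certificate interface (one fake weight)

The easy half of the 2001 duality at a cutoff (`K_a ≠ ∅ ⇒ (S)_a`, archive fefr Thm C) is the
sibling lemma `re_weilArchPolar_nonneg_of_fakeWeight` (`SignConeFakeWeightReduction.lean`, landed
for item stmt-RiemannHypothesis-16302). Here it is specialised to the exact decl of item
stmt-RiemannHypothesis-16307 (`SignCone.SignConeUpTo210`): a certified computation of the 2001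
"Thm S" kind (ball arithmetic on certified zeta zeros + the Platt–Trudgian verification of RH to
height `3·10¹²`) has to produce ONE non-negative weight `c` on the integers `n < 210` together with a
proof that the fake Weil form `W_ar(g ⋆ g̃) − P_c(g ⋆ g̃)` is non-negative on every Weil test `g`
supported in `[-(log 210)/2, (log 210)/2]`; this file turns that into the item. With `c = Λ` the
hypothesis is Weil positivity at cutoff `(log 210)/2` (`SignConeUpTo210_of_weilPositivityOn` in
`SignConeSignConeUpTo210Reduction.lean`, whose module cannot be co-imported with this one: the
Literature modules `WeilWindowSimpleEven` and `WeilGroundStateRealZeros` both declare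
`WeilWindowSimpleEven`).
-/

noncomputable section

-- every Theorems file of this sub-problem declares into `Summit.RiemannHypothesis.RiemannHypothesis.…`
set_option linter.dupNamespace false

open Set

namespace Summit.RiemannHypothesis.RiemannHypothesis.Theorems.SignCone

open Literature.NumberTheory.LFunctions

/-- **`SignConeUpTo210` from a fake-weight certificate at the top cutoff.** If some non-negative
weight `c : ℕ → ℝ` makes the fake Weil form
`W_ar(g ⋆ g̃) − Σₙ c(n) n^{-1/2}((g ⋆ g̃)(log n) + (g ⋆ g̃)(−log n))` non-negative on every Weil test
`g` supported in `[-(log 210)/2, (log 210)/2]`, then the item's exact decl holds: a test supported in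
`[-a, a]` with `a ≤ (log 210)/2` is supported in the top window, and
`re_weilArchPolar_nonneg_of_fakeWeight` gives `0 ≤ Re W_ar(F)` for every node-nonnegative
`F = Σ_i g_i ⋆ g̃_i` (the let-bound `F`, `M` of the route statement are definitionally the
Literature `weilConv`/`weilReflect`/`weilMellin` forms). [folklore] -/
theorem SignConeUpTo210_of_fakeWeight
    (h : ∃ c : ℕ → ℝ, (∀ n, 0 ≤ c n) ∧ ∀ g : ℝ → ℂ, IsWeilTest g →
      tsupport g ⊆ Icc (-(Real.log 210 / 2)) (Real.log 210 / 2) →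
      0 ≤ (weilPolarTerm (weilConv g (weilReflect g)) + weilArchTerm (weilConv g (weilReflect g)) -
        ∑' n : ℕ, ((c n : ℝ) : ℂ) / (Real.sqrt n : ℂ) *
          (weilConv g (weilReflect g) (Real.log n) + weilConv g (weilReflect g) (-Real.log n))).re) :
    Summit.RiemannHypothesis.RiemannHypothesis.Theses.SignCone.SignConeUpTo210 := by
  obtain ⟨c, hc, hW⟩ := h
  intro a _ hle k g hg F hnode M
  -- the item was RESTATED (route rev 5) in the slack form `-(F 0).re ≤ Re W_ar(F)`; since
  -- `F 0 = Σ_i (g_i ⋆ g̃_i)(0) = Σ_i ∫ ‖g_i‖² ≥ 0`, it follows from the exact form `0 ≤ Re W_ar(F)`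
  have hF0 : 0 ≤ (F 0).re := by
    have e : F 0 = ∑ i, weilConv (g i) (weilReflect (g i)) 0 := rfl
    rw [e, Complex.re_sum]
    refine Finset.sum_nonneg fun i _ ↦ ?_
    rw [weilConv_weilReflect_apply_zero, Complex.ofReal_re]
    positivity
  exact le_trans (neg_nonpos.mpr hF0) (re_weilArchPolar_nonneg_of_fakeWeight hc hW rfl (fun i ↦ (hg i).1)
    (fun i ↦ (hg i).2.trans (Icc_subset_Icc (by linarith) hle)) hnode)

end Summit.RiemannHypothesis.RiemannHypothesis.Theorems.SignCone

end
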